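import Summits.BirchSwinnertonDyer.BirchSwinnertonDyer.Theorems.EisensteinPrimesTwistDeformationMahler
import Literature.NumberTheory.IwasawaTheory.Greenberg2006.TwistDeformation
import Literature.NumberTheory.EllipticCurves.Rubin1991.TwoVariableMainConjecture
import HarnessLib


/-!
# Route `EisensteinPrimes` (rung K5), crux 2 `GoodLatticeBDPValue`, line `halves` v5, stub
# `stub_noPseudoNull`, road (γ): Greenberg's twist deformation `𝐃 = D ⊗ Λ̂` over the `ℤ_p²`-tower
# is COFREE OF CORANK ONE over `Λ₂` — the Iwasawa–Serre / Pontryagin input `IsCofree Λ₂ 𝐃`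
# (helper for stmt-BirchSwinnertonDyer-19032)

Cell `bsd-eis`, seat `bsd-eis-k5-c2` (gen 8). Planner RULINGS L36 (2) / L45 (3) / L50 (3) name the
KERNEL PART of road (γ) — Rubin 1991 Thm. 5.3 (v) without `p ∤ h_K` through Greenberg 2016
Prop. 4.1.1 (c) (`Greenberg2016.prop411_selmer_isAlmostDivisible`) for the twist deformation
`𝐃 = twistDeformation S hS κ₁ κ₂ ρ₀` on `IndModule₂ ℤ_[p] p A` (`Greenberg2006/TwistDeformation.lean`,
k5-ty p505369/p506695/p508639) — as owed by a `k5-c2`-class prover seat; its FIRST named gap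
(TwistDeformation.lean module docstring "GAP"; k5-ty STATUS 2026-08-27 06:51Z (2) "NOT offered
(L-size, named GAP): IsCofree Λ₂ 𝐃 (Iwasawa–Serre iso + Pontryagin duality)") is the hypothesis
`IsCofree R 𝐃` (`R = Λ = Λ₂`) carried by `prop411_…`, `prop422_…` and, through
`IsCofinitelyGenerated`, by `prop41_…`, `prop42_…`, `sec5A_…`; it also gives RFX(`𝐃`)
(`IsCofree.rfx`) and the freeness of the Tate duals `T* = Hom(𝐃, μ_{p^∞})` behind LOC⁽²⁾.

THIS FILE CLOSES THAT GAP, for any discrete `p`-primary `ℤ_p`-module `A` "of corank one with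
respect to `C`-duality" — i.e. equipped with an additive `j : A → C` through which
`ℤ_p ≅ Hom(A, C)`, `c ↦ j ∘ (c • ·)` (for `A ≅ ℚ_p/ℤ_p`: `C = ℚ/ℤ` gives Pontryagin duals, `C = K̄ˣ`
gives Tate duals): EVERY `Λ₂`-balanced dual `X ≅ Hom(𝐃, C)` (`Greenberg2016.IsDualPairing`) is
isomorphic to `Λ₂` as a `Λ₂`-module (`nonempty_linearEquiv_of_isDualPairing`), whence
`IsCofree Λ₂ 𝐃`, `HasCorank Λ₂ 𝐃 1`, `IsCofinitelyGenerated Λ₂ 𝐃`, `RFX Λ₂ 𝐃`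
(`isCofree_indModule₂`, `hasCorank_one_indModule₂`, …). The proof is the finite MAHLER EXPANSION of
smooth `p`-primary functions: the binomial functions `x ↦ binom(x, i) • b` (Mathlib's `Ring.choose` on
the binomial ring `ℤ_[p]`, continuous by `PadicInt.continuous_choose`) lie in the co-induced module,
`τ₁ - 1` lowers the index (Pascal), every element is the FINITE sum `∑ᵢ binom(·, i) • (Δⁱ Φ)(0)`
(Gregory–Newton `shift_eq_sum_fwdDiff_iter` on `ℕ ⊂ ℤ_p` plus local constancy), and the moment
pairing `F ↦ (Φ ↦ j((F • Φ)(0)(0)))` reads off the coefficient `coeff_{ij}(F)` on the `(i, j)`-th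
Mahler element — so it is a bijection `Λ₂ ≅ Hom(𝐃, C)`; any abstract balanced dual is then the free
cyclic module on the preimage of the moment functional. Elementary and unconditional; no named fact,
no `sorry`. HONEST FRAMING: closes nothing by itself (`--supports`); the remaining named gaps of road
(γ) — LEO (weak Leopoldt + Shapiro in degree 2), CRK (Euler–Poincaré coranks + Shapiro), LOC⁽²⁾ on
`Σ`, the Shapiro bridge `S_𝓛(K, 𝐃)^∨ ↔ Rubin1991.DualData₂.X` — are untouched here.

References: [Greenberg2006] p. 342 L5–11 ("`𝒟 = 𝒯 ⊗_Λ Λ̂` … a cofree `Λ`-module"); [Greenberg2016Selmer]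
§4.3 p. 20 L19–23; [SkinnerUrban2014] Prop. 3.2.3 (`Λ^* = lim Maps(Γ/Γ^{pⁿ}, ·)`); K. Mahler /
P. Colmez, *Fonctions d'une variable p-adique* §1.2.1 (Mahler basis; Mathlib `MahlerBasis.lean`);
J.-P. Serre, *Classes des corps cyclotomiques*, Sém. Bourbaki 174 (the isomorphism `ℤ_p[[Γ]] ≅ ℤ_p⟦T⟧`).
-/

set_option autoImplicit false
set_option linter.dupNamespace false

noncomputable section

open scoped Classical fwdDiff
open Finset PowerSeries
open Literature.NumberTheory.EllipticCurves Literature.NumberTheory.IwasawaTheory.Greenberg2016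
  Literature.NumberTheory.IwasawaTheory.Greenberg2006

namespace Summit.BirchSwinnertonDyer.BirchSwinnertonDyer.Theorems.TwistDeformationCofree

/-! ## §3 Two variables: the moment pairing `Λ₂ × 𝐃 → A` and its Mahler (dual) basis -/

section TwoVar

variable {p : ℕ} [Fact p.Prime] {A : Type} [AddCommGroup A] [Module ℤ_[p] A]

/-- The inner co-induced module `A' = Maps^∞(Γ₂, A)` is `p`-primary as a `ℤ_p`-module (every element
is killed by a power of `p`), so that the OUTER Mahler elements `binom i Ψ`, `Ψ ∈ A'`, make sense.
[cite: SkinnerUrban2014, §3.1.3 and proof of Prop. 3.2.3 (Λ^* = lim Hom(ℤ[Gal(F_n/F)], ·))] -/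
theorem inner_pPrimary : ∀ Ψ : BigRepModule ℤ_[p] p A, ∃ k : ℕ, p ^ k • Ψ = 0 :=
  fun Ψ ↦ exists_pow_smul_eq_zero Ψ

/-- **The `(i, j)`-th two-variable Mahler element** `(x, y) ↦ binom(x, i) binom(y, j) • a` of
`𝐃 = Ind_{K̃_∞/K}(A) = Maps^∞(Γ₁ × Γ₂, A)` (curried: the outer Mahler element with value the inner
Mahler element), additive in `a`. [folklore] -/
def mahler₂ (hA : ∀ a : A, ∃ k : ℕ, p ^ k • a = 0) (i j : ℕ) : A →+ IndModule₂ ℤ_[p] p A :=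
  (binom (R := PowerSeries ℤ_[p]) inner_pPrimary i).comp (binom (R := ℤ_[p]) hA j)

/-- Unfolding `mahler₂`: `(mahler₂ i j a)(x)(y) = binom(x, i) • binom(y, j) • a`. [folklore] -/
@[simp] theorem mahler₂_apply_apply (hA : ∀ a : A, ∃ k : ℕ, p ^ k • a = 0) (i j : ℕ) (a : A)
    (x y : ℤ_[p]) : mahler₂ hA i j a x y = Ring.choose x i • Ring.choose y j • a := rfl

/-- Unfolding `mahler₂` once: `(mahler₂ i j a)(x) = binom(x, i) • binom j a` in `A'`. [folklore] -/
theorem mahler₂_apply (hA : ∀ a : A, ∃ k : ℕ, p ^ k • a = 0) (i j : ℕ) (a : A) (x : ℤ_[p]) :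
    mahler₂ hA i j a x = Ring.choose x i • binom (R := ℤ_[p]) hA j a := rfl

/-- **The `(a, b)`-th MOMENT** `Φ ↦ ((τ₂ - 1)^b (((τ₁ - 1)^a Φ)(0)))(0) ∈ A` of `Φ ∈ 𝐃` — the
coefficient functional dual to `T₁^a T₂^b`, additive in `Φ`. [folklore] -/
def moment (a b : ℕ) : IndModule₂ ℤ_[p] p A →+ A :=
  ((evalₗ ℤ_[p] (0 : ℤ_[p])).comp
      (BigRepModule.shiftSubOne ^ b : BigRepModule ℤ_[p] p A →ₗ[ℤ_[p]] BigRepModule ℤ_[p] p A)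
    ).toAddMonoidHom.comp
    (((evalₗ (PowerSeries ℤ_[p]) (0 : ℤ_[p])).comp
      (BigRepModule.shiftSubOne ^ a :
        IndModule₂ ℤ_[p] p A →ₗ[PowerSeries ℤ_[p]] IndModule₂ ℤ_[p] p A)).toAddMonoidHom)

/-- Unfolding `moment`. [folklore] -/
theorem moment_apply (a b : ℕ) (Φ : IndModule₂ ℤ_[p] p A) :
    moment a b Φ =
      ((BigRepModule.shiftSubOne ^ b : BigRepModule ℤ_[p] p A →ₗ[ℤ_[p]] BigRepModule ℤ_[p] p A)
        (((BigRepModule.shiftSubOne ^ a :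
          IndModule₂ ℤ_[p] p A →ₗ[PowerSeries ℤ_[p]] IndModule₂ ℤ_[p] p A) Φ) 0)) 0 := rfl

/-- **The Mahler elements are dual to the moments**: `moment a b (mahler₂ i j c) = c` if
`(a, b) = (i, j)` and `0` otherwise. [folklore] -/
theorem moment_mahler₂ (hA : ∀ a : A, ∃ k : ℕ, p ^ k • a = 0) (a b i j : ℕ) (c : A) :
    moment a b (mahler₂ hA i j c) = if a = i ∧ b = j then c else 0 := by
  rw [moment_apply, mahler₂, AddMonoidHom.comp_apply, shiftSubOne_pow_binom_apply_zero]
  by_cases hai : a = i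
  · rw [if_pos hai, shiftSubOne_pow_binom_apply_zero]
    by_cases hbj : b = j
    · rw [if_pos hbj, if_pos ⟨hai, hbj⟩]
    · rw [if_neg hbj, if_neg (fun h ↦ hbj h.2)]
  · rw [if_neg hai, LinearMap.map_zero, BigRepModule.zero_apply, if_neg (fun h ↦ hai h.1)]

/-- The outer moments `((τ₁ - 1)^a Φ)(0)` are `ℤ`-combinations of values of `Φ`, so an inner
exponent killing every value of `Φ` kills them. [folklore] -/
theorem inner_pow_apply_outer_eq_zero {N a : ℕ} {Φ : IndModule₂ ℤ_[p] p A}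
    (h₂ : ∀ x : ℤ_[p],
      (BigRepModule.shiftSubOne ^ N : BigRepModule ℤ_[p] p A →ₗ[ℤ_[p]] BigRepModule ℤ_[p] p A)
        (Φ x) = 0) :
    (BigRepModule.shiftSubOne ^ N : BigRepModule ℤ_[p] p A →ₗ[ℤ_[p]] BigRepModule ℤ_[p] p A)
      (((BigRepModule.shiftSubOne ^ a :
        IndModule₂ ℤ_[p] p A →ₗ[PowerSeries ℤ_[p]] IndModule₂ ℤ_[p] p A) Φ) 0) = 0 := by
  rw [shiftSubOne_pow_apply, fwdDiff_iter_eq_sum_shift, map_sum]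
  exact sum_eq_zero fun k _ ↦ by rw [map_zsmul, h₂, smul_zero]

/-- **A uniform nilpotency exponent**: for `Φ ∈ 𝐃` some `N` has `(τ₁ - 1)^N Φ = 0` and
`(τ₂ - 1)^N (Φ x) = 0` for EVERY `x` (the values `Φ x` run over the finitely many `Φ(r)`,
`r < pⁿ`, `n` a level of `Φ`). [folklore] -/
theorem exists_uniform_pow_eq_zero (Φ : IndModule₂ ℤ_[p] p A) : ∃ N : ℕ,
    (BigRepModule.shiftSubOne ^ N :
        IndModule₂ ℤ_[p] p A →ₗ[PowerSeries ℤ_[p]] IndModule₂ ℤ_[p] p A) Φ = 0 ∧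
      ∀ x : ℤ_[p],
        (BigRepModule.shiftSubOne ^ N : BigRepModule ℤ_[p] p A →ₗ[ℤ_[p]] BigRepModule ℤ_[p] p A)
          (Φ x) = 0 := by
  obtain ⟨N₁, h₁⟩ := BigRepModule.shiftSubOne_locNil Φ
  obtain ⟨n, hn⟩ := Φ.exists_level
  choose M hM using fun r : ℕ ↦
    BigRepModule.shiftSubOne_locNil (𝒪 := ℤ_[p]) (p := p) (A := A) (Φ (r : ℤ_[p]))
  refine ⟨N₁ + (range (p ^ n)).sup M, ?_, fun x ↦ ?_⟩
  · rw [add_comm, pow_add, Module.End.mul_apply, h₁, LinearMap.map_zero]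
  · have hx : Φ x = Φ ((x.appr n : ℕ) : ℤ_[p]) := hn _ _ (PadicInt.appr_spec n x)
    have hle : M (x.appr n) ≤ N₁ + (range (p ^ n)).sup M :=
      (le_sup (f := M) (mem_range.mpr (PadicInt.appr_lt x n))).trans (Nat.le_add_left _ _)
    rw [hx, ← Nat.sub_add_cancel hle, pow_add, Module.End.mul_apply, hM, LinearMap.map_zero]

/-- **The moment expansion of the `Λ₂`-action at the origin**: with a uniform exponent `N` as in
`exists_uniform_pow_eq_zero`, `(F • Φ)(0)(0) = ∑_{a<N} ∑_{b<N} coeff_b(coeff_a F) • moment a b Φ`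
(`F = ∑ coeff_{ab} T₁^a T₂^b` acts through `T₁ ↦ τ₁ - 1`, `T₂ ↦ τ₂ - 1`).
[cite: Greenberg2010, §5 (PDF p. 26 L1–4) (sending xᵢ to γᵢ − 1)] -/
theorem smul_apply_zero_zero {N : ℕ} {Φ : IndModule₂ ℤ_[p] p A}
    (h₁ : (BigRepModule.shiftSubOne ^ N :
        IndModule₂ ℤ_[p] p A →ₗ[PowerSeries ℤ_[p]] IndModule₂ ℤ_[p] p A) Φ = 0)
    (h₂ : ∀ x : ℤ_[p],
      (BigRepModule.shiftSubOne ^ N : BigRepModule ℤ_[p] p A →ₗ[ℤ_[p]] BigRepModule ℤ_[p] p A)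
        (Φ x) = 0)
    (F : IwasawaAlgebra₂ p) :
    (F • Φ) 0 0 = ∑ a ∈ range N, ∑ b ∈ range N, coeff b (coeff a F) • moment a b Φ := by
  rw [powerSeries_smul_apply_eq_sum h₁ F 0, sum_apply]
  refine sum_congr rfl fun a _ ↦ ?_
  rw [powerSeries_smul_apply_eq_sum (inner_pow_apply_outer_eq_zero h₂) (coeff a F) 0]
  rfl

/-- **The moment pairing on a Mahler element reads off one coefficient**:
`(F • mahler₂ i j c)(0)(0) = coeff_j(coeff_i F) • c`. [folklore] -/
theorem smul_mahler₂_apply_zero_zero (hA : ∀ a : A, ∃ k : ℕ, p ^ k • a = 0) (F : IwasawaAlgebra₂ p)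
    (i j : ℕ) (c : A) : (F • mahler₂ hA i j c) 0 0 = coeff j (coeff i F) • c := by
  set N := max i j + 1 with hN
  have hiN : i < N := by omega
  have hjN : j < N := by omega
  have h₁ : (BigRepModule.shiftSubOne ^ N :
      IndModule₂ ℤ_[p] p A →ₗ[PowerSeries ℤ_[p]] IndModule₂ ℤ_[p] p A) (mahler₂ hA i j c) = 0 := by
    rw [mahler₂, AddMonoidHom.comp_apply, shiftSubOne_pow_binom, if_neg (by omega)]
  have h₂ : ∀ x : ℤ_[p],
      (BigRepModule.shiftSubOne ^ N : BigRepModule ℤ_[p] p A →ₗ[ℤ_[p]] BigRepModule ℤ_[p] p A)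
        (mahler₂ hA i j c x) = 0 := fun x ↦ by
    rw [mahler₂_apply, map_smul, shiftSubOne_pow_binom, if_neg (by omega), smul_zero]
  rw [smul_apply_zero_zero h₁ h₂ F]
  simp_rw [moment_mahler₂]
  rw [sum_eq_single_of_mem i (mem_range.mpr hiN) fun a _ hai ↦ sum_eq_zero fun b _ ↦ by
    rw [if_neg (fun h ↦ hai h.1), smul_zero]]
  simp_rw [true_and, smul_ite, smul_zero]
  rw [Finset.sum_ite_eq' (range N) j (fun b ↦ coeff b (coeff i F) • c), if_pos (mem_range.mpr hjN)]

end TwoVar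

/-! ## §4 The moment pairing `Λ₂ ≅ Hom(𝐃, C)` and the structure of every balanced dual -/

section Duality

variable {p : ℕ} [Fact p.Prime] {A : Type} [AddCommGroup A] [Module ℤ_[p] A]
  {C : Type*} [AddCommGroup C] (jC : A →+ C)

/-- **Two-variable finite Mahler expansion**: with a uniform exponent `N`,
`Φ = ∑_{i<N} ∑_{j<N} mahler₂ i j (moment i j Φ)` for every `Φ ∈ 𝐃`. [folklore] -/
theorem eq_sum_mahler₂ (hA : ∀ a : A, ∃ k : ℕ, p ^ k • a = 0) {N : ℕ} {Φ : IndModule₂ ℤ_[p] p A}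
    (h₁ : (BigRepModule.shiftSubOne ^ N :
        IndModule₂ ℤ_[p] p A →ₗ[PowerSeries ℤ_[p]] IndModule₂ ℤ_[p] p A) Φ = 0)
    (h₂ : ∀ x : ℤ_[p],
      (BigRepModule.shiftSubOne ^ N : BigRepModule ℤ_[p] p A →ₗ[ℤ_[p]] BigRepModule ℤ_[p] p A)
        (Φ x) = 0) :
    Φ = ∑ i ∈ range N, ∑ j ∈ range N, mahler₂ hA i j (moment i j Φ) := by
  have step₁ := eq_sum_binom (R := PowerSeries ℤ_[p]) (inner_pPrimary (A := A)) h₁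
  refine step₁.trans (sum_congr rfl fun i _ ↦ ?_)
  have step₂ := eq_sum_binom (R := ℤ_[p]) hA (inner_pow_apply_outer_eq_zero (a := i) h₂)
  rw [step₂, map_sum]
  rfl

/-- Evaluation at the origin `Φ ↦ Φ(0)(0)` of `Γ₁ × Γ₂`, additive. [folklore] -/
def evalOrigin : IndModule₂ ℤ_[p] p A →+ A where
  toFun Φ := Φ 0 0
  map_zero' := rfl
  map_add' _ _ := rfl

/-- Unfolding `evalOrigin`. [folklore] -/
@[simp] theorem evalOrigin_apply (Φ : IndModule₂ ℤ_[p] p A) : evalOrigin Φ = Φ 0 0 := rfl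

/-- **The MOMENT PAIRING** `Λ₂ → Hom(𝐃, C)`, `F ↦ (Φ ↦ j((F • Φ)(0)(0)))` — "`∫ Φ dF`" read through
`j : A → C` —, additive in `F`; the map that identifies `Λ₂ = ℤ_p[[Γ]]` with the `C`-dual of the
co-induced module (Iwasawa–Serre + Pontryagin, [Greenberg2006] p. 342: "`𝒟 = 𝒯 ⊗_Λ Λ̂`, which is a
cofree `Λ`-module"). [cite: Greenberg2006, p. 342 L5–11] -/
def momentPairing : IwasawaAlgebra₂ p →+ (IndModule₂ ℤ_[p] p A →+ C) where
  toFun F := jC.comp (evalOrigin.comp (DistribSMul.toAddMonoidHom (IndModule₂ ℤ_[p] p A) F))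
  map_zero' := by
    ext Φ
    simp only [AddMonoidHom.comp_apply, DistribSMul.toAddMonoidHom_apply, zero_smul, map_zero,
      AddMonoidHom.zero_apply]
  map_add' F G := by
    ext Φ
    simp only [AddMonoidHom.comp_apply, DistribSMul.toAddMonoidHom_apply, add_smul, map_add,
      AddMonoidHom.add_apply]

/-- Unfolding the moment pairing: `momentPairing j F Φ = j ((F • Φ)(0)(0))`. [cite: Greenberg2006, p. 342 L5–11] -/
@[simp] theorem momentPairing_apply (F : IwasawaAlgebra₂ p) (Φ : IndModule₂ ℤ_[p] p A) :
    momentPairing jC F Φ = jC ((F • Φ) 0 0) := rfl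

/-- **The moment pairing is injective** as soon as `ℤ_p → Hom(A, C)`, `c ↦ j ∘ (c • ·)` is: its value
on the `(i, j)`-th Mahler element is `j(coeff_{ij}(F) • a)`. [cite: Greenberg2006, p. 342 L5–11] -/
theorem momentPairing_injective (hA : ∀ a : A, ∃ k : ℕ, p ^ k • a = 0)
    (hinj : ∀ c : ℤ_[p], (∀ a : A, jC (c • a) = 0) → c = 0) :
    Function.Injective (momentPairing (p := p) (A := A) jC) := by
  refine (injective_iff_map_eq_zero _).mpr fun F hF ↦ ?_
  refine PowerSeries.ext fun i ↦ PowerSeries.ext fun j ↦ ?_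
  rw [map_zero, map_zero]
  refine hinj _ fun a ↦ ?_
  rw [← smul_mahler₂_apply_zero_zero hA F i j a, ← momentPairing_apply jC, hF,
    AddMonoidHom.zero_apply]

/-- **The moment pairing is surjective** as soon as every additive `A → C` is `j ∘ (c • ·)` for some
`c ∈ ℤ_p`: the preimage of `g ∈ Hom(𝐃, C)` is the series whose `(i, j)`-th coefficient represents
`g ∘ mahler₂ i j`, by the finite Mahler expansion. [cite: Greenberg2006, p. 342 L5–11] -/
theorem momentPairing_surjective (hA : ∀ a : A, ∃ k : ℕ, p ^ k • a = 0)
    (hsurj : ∀ φ : A →+ C, ∃ c : ℤ_[p], ∀ a : A, φ a = jC (c • a)) :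
    Function.Surjective (momentPairing (p := p) (A := A) jC) := by
  intro g
  choose c hc using fun ij : ℕ × ℕ ↦ hsurj (g.comp (mahler₂ hA ij.1 ij.2))
  refine ⟨PowerSeries.mk fun i ↦ PowerSeries.mk fun j ↦ c (i, j), ?_⟩
  ext Φ
  obtain ⟨N, h₁, h₂⟩ := exists_uniform_pow_eq_zero Φ
  rw [eq_sum_mahler₂ hA h₁ h₂, map_sum, map_sum]
  refine sum_congr rfl fun i _ ↦ ?_
  rw [map_sum, map_sum]
  refine sum_congr rfl fun j _ ↦ ?_
  rw [momentPairing_apply, smul_mahler₂_apply_zero_zero, coeff_mk, coeff_mk]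
  exact (hc (i, j) _).symm

/-- **Structure of the balanced duals of `𝐃` (Iwasawa–Serre + Pontryagin, corank one)**: if `A` is a
`p`-primary `ℤ_p`-module with `ℤ_p ≅ Hom(A, C)` through `j` (`c ↦ j ∘ (c • ·)` injective and onto),
then EVERY `Λ₂`-balanced `C`-dual `X ≅ Hom(𝐃, C)` of `𝐃 = Ind_{K̃_∞/K}(A)`
(`Greenberg2016.IsDualPairing Λ₂ 𝐃 toDual`) is isomorphic to `Λ₂` as a `Λ₂`-module: it is the free
cyclic module on the preimage `x₀` of the moment functional `j ∘ evalOrigin`, because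
`toDual (F • x₀) = momentPairing j F` and the moment pairing is a bijection `Λ₂ ≅ Hom(𝐃, C)`. With
`C = ℚ/ℤ` this is "`𝒟` is a cofree `Λ`-module" of rank one ([Greenberg2006] p. 342 L7), with
`C = K̄ˣ` it is "`T* ≅ Λ`" (the Tate dual, [Greenberg2016Selmer] p. 5). [cite: Greenberg2006, p. 342 L5–11]
[cite: Greenberg2016Selmer, §4.3 p. 20 L19–23] -/
theorem nonempty_linearEquiv_of_isDualPairing (hA : ∀ a : A, ∃ k : ℕ, p ^ k • a = 0)
    (hinj : ∀ c : ℤ_[p], (∀ a : A, jC (c • a) = 0) → c = 0)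
    (hsurj : ∀ φ : A →+ C, ∃ c : ℤ_[p], ∀ a : A, φ a = jC (c • a))
    {X : Type} [AddCommGroup X] [Module (IwasawaAlgebra₂ p) X]
    {toDual : X →+ (IndModule₂ ℤ_[p] p A →+ C)}
    (hX : IsDualPairing (IwasawaAlgebra₂ p) (IndModule₂ ℤ_[p] p A) toDual) :
    Nonempty (X ≃ₗ[IwasawaAlgebra₂ p] IwasawaAlgebra₂ p) := by
  obtain ⟨x₀, hx₀⟩ := hX.bijective.2 (momentPairing jC 1)
  let ψ : IwasawaAlgebra₂ p →ₗ[IwasawaAlgebra₂ p] X := LinearMap.toSpanSingleton _ _ x₀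
  have hψ : ∀ F, toDual (ψ F) = momentPairing jC F := by
    intro F
    ext Φ
    rw [LinearMap.toSpanSingleton_apply, hX.map_smul, hx₀, momentPairing_apply,
      momentPairing_apply, one_smul]
  have hbij : Function.Bijective ψ := by
    constructor
    · intro F G h
      apply momentPairing_injective jC hA hinj
      rw [← hψ, ← hψ, h]
    · intro x
      obtain ⟨F, hF⟩ := momentPairing_surjective jC hA hsurj (toDual x)
      exact ⟨F, hX.injective (by rw [hψ, hF])⟩
  exact ⟨(LinearEquiv.ofBijective ψ hbij).symm⟩

/-- **`𝐃 = Ind_{K̃_∞/K}(A)` IS A COFREE `Λ₂`-MODULE** (every Pontryagin dual is finite free) — the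
hypothesis `IsCofree R 𝐃` (`R = Λ = Λ₂`) of `Greenberg2016.prop411_selmer_isAlmostDivisible` /
`prop422_localCohomology_isAlmostDivisible` for the twist deformation, for `A` `p`-primary of
Pontryagin corank one (`ℤ_p ≅ Hom(A, ℚ/ℤ)` through `j`, e.g. `A ≅ ℚ_p/ℤ_p`).
[cite: Greenberg2006, p. 342 L5–11 ("𝒟 = 𝒯 ⊗_Λ Λ̂, which is a cofree Λ-module")]
[cite: Greenberg2016Selmer, §4.3 p. 20 L19–23 ("This discrete, Λ-cofree Gal(K_Σ/K)-module 𝒟")] -/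
theorem isCofree_indModule₂ (hA : ∀ a : A, ∃ k : ℕ, p ^ k • a = 0) (jQ : A →+ AddCircle (1 : ℚ))
    (hinj : ∀ c : ℤ_[p], (∀ a : A, jQ (c • a) = 0) → c = 0)
    (hsurj : ∀ φ : A →+ AddCircle (1 : ℚ), ∃ c : ℤ_[p], ∀ a : A, φ a = jQ (c • a)) :
    IsCofree (IwasawaAlgebra₂ p) (IndModule₂ ℤ_[p] p A) := by
  intro X _ _ toDual hX
  obtain ⟨e⟩ := nonempty_linearEquiv_of_isDualPairing jQ hA hinj hsurj hX
  exact ⟨Module.Free.of_equiv e.symm, Module.Finite.equiv e.symm⟩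

/-- **`corank_{Λ₂} 𝐃 = 1`** (every Pontryagin dual has rank one) — the `m = 1` input of
`Greenberg2006.prop41_globalEulerPoincareCorank` / `prop42_localEulerPoincareCorank` for the twist
deformation of a corank-one `A`. [cite: Greenberg2006, p. 342 L5–11] [cite: Greenberg2016Selmer, §4.3 p. 20 L9–23] -/
theorem hasCorank_one_indModule₂ (hA : ∀ a : A, ∃ k : ℕ, p ^ k • a = 0) (jQ : A →+ AddCircle (1 : ℚ))
    (hinj : ∀ c : ℤ_[p], (∀ a : A, jQ (c • a) = 0) → c = 0)
    (hsurj : ∀ φ : A →+ AddCircle (1 : ℚ), ∃ c : ℤ_[p], ∀ a : A, φ a = jQ (c • a)) :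
    HasCorank (IwasawaAlgebra₂ p) (IndModule₂ ℤ_[p] p A) 1 := by
  intro X _ _ toDual hX
  obtain ⟨e⟩ := nonempty_linearEquiv_of_isDualPairing jQ hA hinj hsurj hX
  rw [e.finrank_eq, Module.finrank_self]

/-- `𝐃` is cofinitely generated over `Λ₂` (the standing clause of `prop41_…`, `prop42_…`, `sec5A_…`).
[cite: Greenberg2006, §4 p. 367 L33–39] -/
theorem isCofinitelyGenerated_indModule₂ (hA : ∀ a : A, ∃ k : ℕ, p ^ k • a = 0) (jQ : A →+ AddCircle (1 : ℚ))
    (hinj : ∀ c : ℤ_[p], (∀ a : A, jQ (c • a) = 0) → c = 0)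
    (hsurj : ∀ φ : A →+ AddCircle (1 : ℚ), ∃ c : ℤ_[p], ∀ a : A, φ a = jQ (c • a)) :
    IsCofinitelyGenerated (IwasawaAlgebra₂ p) (IndModule₂ ℤ_[p] p A) :=
  IsCofree.isCofinitelyGenerated (isCofree_indModule₂ hA jQ hinj hsurj)

/-- **RFX(`𝐃`)** for the twist deformation of a corank-one `A` ("Obviously, RFX(`𝒟`) is satisfied").
[cite: Greenberg2016Selmer, §4.3 p. 20 L23] -/
theorem rfx_indModule₂ (hA : ∀ a : A, ∃ k : ℕ, p ^ k • a = 0) (jQ : A →+ AddCircle (1 : ℚ))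
    (hinj : ∀ c : ℤ_[p], (∀ a : A, jQ (c • a) = 0) → c = 0)
    (hsurj : ∀ φ : A →+ AddCircle (1 : ℚ), ∃ c : ℤ_[p], ∀ a : A, φ a = jQ (c • a)) :
    RFX (IwasawaAlgebra₂ p) (IndModule₂ ℤ_[p] p A) :=
  IsCofree.rfx (isCofree_indModule₂ hA jQ hinj hsurj)

end Duality

end Summit.BirchSwinnertonDyer.BirchSwinnertonDyer.Theorems.TwistDeformationCofree

end
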